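import Literature.Probability.Percolation.PercolationProofs
import Summits.CriticalPhenomena.PercolationContinuityZ3.Theorems.AdditiveGluing.Negative.CertWitness

/-!
# `NoHeavyLowerTail` (crux stmt-CriticalPhenomena-4575 ≡ KN Conjecture 3), certificate programme:
# a certified weighted COUNTEREXAMPLE to the INCLUSIVE-threshold `C = 1` linear lower-tail form

The crux bounds the lower tail of `N = |C(o) ∩ A|` (the number of relays of `A` joined to the
observer `o`).  Its finitely-checkable LINEAR proxy (line `bhk-superadditivity-thinning`) reads
`P(1 ≤ N, N small) ≤ C · (P(o ↮ A) + max_{a, a' ∈ A} P(a ↮ a'))`.  With the STRICT / `EN/2`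
threshold this is what the neighbouring certificates verify on small windows; the present file shows
that the natural strengthening with the INCLUSIVE half threshold `2N ≤ |A|` and the constant `C = 1`,

  `P(1 ≤ N ∧ 2N ≤ |A|) ≤ P(o ↮ A) + P(a ↮ a')` for some `a, a' ∈ A`,

is FALSE already on five vertices at low reliability.  The witness (found by the compute seat's exact
sweep of the `U5` window, kit job j018493, and re-derived here inside Lean with exact rational
arithmetic): the complete graph `K₄` on `{0, 1, 2, 3}` with every edge of weight `1/8`, plus the pair
`{3, 4}` of weight `1`; observer `o = 3`, relay set `A = {0, 1, 2, 4}` (`o ∉ A`, `|A| = 4`).  Then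
`P(o ↮ A) = 0` (`o` is glued to the relay `4`), `P(a ↮ a') = 110789/131072` for all `a ≠ a'` in `A`
(and `0` for `a = a'`), while `{1 ≤ N ∧ 2N ≤ 4} = {o is joined to at most one of 0, 1, 2}` has
probability `29155/32768 = 116620/131072`: ratio `20/19 > 1`.

Method: the exact-rational weighted machinery of `CertWeighted.lean` — under `prodBernoulli (wOfList l)`
the probability of ANY event is a weighted count over the `2^7` sub-configurations
(`prodBernoulli_real_eq_wsum`); `P(a ↮ a') = wNotConn` (`real_compl_openConn_eq_wNotConn`); the
`N`-count event is read off the reach tables bit by bit (`testBit_reachTable_iff_mem_openConn`,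
`linIncCex_le_real_lowCount`); the three rational numbers are evaluated by `native_decide`.

Scope.  This refutes ONLY the inclusive-threshold `C = 1` linear form.  The strict-threshold form,
the `EN/2`-threshold form (`linearLowerTail_half_le_seven` and its uniform analogues) and the crux
`NoHeavyLowerTail` itself are untouched: nothing here asserts or refutes the crux.
-/

namespace Summit.CriticalPhenomena.PercolationContinuityZ3.Theorems

open MeasureTheory
open Literature.Probability.LatticeModels Literature.Probability.Percolation
open Summit.CriticalPhenomena.PercolationContinuityZ3.Theorems.AdditiveGluing.Negative.Cert

open Classical in
/-- **The low-count event as a certified weighted count.**  For a weighted edge list `l` (distinct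
pairs, weights in `[0, 1]`), an observer `o` and a relay set `A`, the probability under
`prodBernoulli (wOfList l)` of `{1 ≤ N ∧ 2N ≤ |A|}`, `N = #{x ∈ A : o ↔ x}`, is bounded below by any
rational `q` that is at most the weighted count of the same `Bool` test on the reach tables
(`wtabs`): in fact the two are EQUAL (`prodBernoulli_real_eq_wsum` + `cast_sum_wtabs_pos`, the
per-configuration agreement being `testBit_reachTable_iff_mem_openConn`); only `≤` is recorded.
A tool for refuting the inclusive-threshold `C = 1` linear lower-tail form ONLY; it says nothing about
the crux. -/
theorem linIncCex_le_real_lowCount {n : ℕ} {l : List (Fin n × Fin n × ℚ)} (hnd : (wPairs l).Nodup)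
    (hq : ∀ e ∈ l, 0 ≤ e.2.2 ∧ e.2.2 ≤ 1) (o : Fin n) (A : Finset (Fin n)) {q : ℚ}
    (h : q ≤ ((wtabs n l).map fun t =>
      if decide (1 ≤ (A.filter fun x : Fin n => (t.1.getD o 0).testBit x = true).card ∧
          2 * (A.filter fun x : Fin n => (t.1.getD o 0).testBit x = true).card ≤ A.card)
        then t.2 else 0).sum) :
    (q : ℝ) ≤ (prodBernoulli (wOfList l)).real
      {ω | 1 ≤ (A.filter fun x => ω ∈ openConn o x).card ∧
        2 * (A.filter fun x => ω ∈ openConn o x).card ≤ A.card} := by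
  rw [prodBernoulli_real_eq_wsum hnd hq,
    ← cast_sum_wtabs_pos l
      (fun tb : List ℕ => decide
        (1 ≤ (A.filter fun x : Fin n => (tb.getD o 0).testBit x = true).card ∧
          2 * (A.filter fun x : Fin n => (tb.getD o 0).testBit x = true).card ≤ A.card))
      (fun S : Finset (Sym2 (Fin n)) => (↑S : Set (Sym2 (Fin n))) ∈
        {ω' : Set (Sym2 (Fin n)) | 1 ≤ (A.filter fun x => ω' ∈ openConn o x).card ∧
          2 * (A.filter fun x => ω' ∈ openConn o x).card ≤ A.card})
      (fun ω => by
        -- per configuration, `o ↔ x` is bit `x` of row `o` of the reach table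
        have hfilt : (A.filter fun x => (↑(Eset ω) : Set (Sym2 (Fin n))) ∈ openConn o x) =
            A.filter fun x : Fin n => ((reachTable n ω).getD o 0).testBit x = true :=
          Finset.filter_congr fun x _ => (testBit_reachTable_iff_mem_openConn ω o x).symm
        simp only [decide_eq_true_eq, Set.mem_setOf_eq]
        rw [hfilt])]
  exact_mod_cast h

open Classical in
/-- **From four checkable rational facts to a violating instance.**  Let `l` be a weighted edge list
(distinct pairs, weights in `[0, 1]`), `A` a relay set containing a relay `a₀` that is glued to the
observer (`wNotConn o a₀ = 0`, so `P(o ↮ A) = 0`), let `η` bound `wNotConn a a' = P(a ↮ a')` on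
`A × A`, and let `q > η` be a certified lower bound for the weighted count of the low-count test.
Then for ALL `a, a' ∈ A`: `P(o ↮ A) + P(a ↮ a') < P(1 ≤ N ∧ 2N ≤ |A|)` under `prodBernoulli (wOfList l)`
— the negation, at these weights, of the inclusive-threshold `C = 1` linear lower-tail form (and of
nothing else: the crux is untouched). -/
theorem linIncCex_of_checks {n : ℕ} (l : List (Fin n × Fin n × ℚ)) (hnd : (wPairs l).Nodup)
    (hq : ∀ e ∈ l, 0 ≤ e.2.2 ∧ e.2.2 ≤ 1) (A : Finset (Fin n)) (o a₀ : Fin n) (ha₀ : a₀ ∈ A)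
    (η q : ℚ) (hglue : wNotConn (wtabs n l) o a₀ = 0)
    (hpair : ∀ a ∈ A, ∀ a' ∈ A, wNotConn (wtabs n l) a a' ≤ η)
    (hlow : q ≤ ((wtabs n l).map fun t =>
      if decide (1 ≤ (A.filter fun x : Fin n => (t.1.getD o 0).testBit x = true).card ∧
          2 * (A.filter fun x : Fin n => (t.1.getD o 0).testBit x = true).card ≤ A.card)
        then t.2 else 0).sum)
    (hlt : η < q) :
    ∀ a ∈ A, ∀ a' ∈ A, (prodBernoulli (wOfList l)).real (⋃ x ∈ A, openConn o x)ᶜ +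
      (prodBernoulli (wOfList l)).real (openConn a a')ᶜ <
      (prodBernoulli (wOfList l)).real {ω | 1 ≤ (A.filter fun x => ω ∈ openConn o x).card ∧
        2 * (A.filter fun x => ω ∈ openConn o x).card ≤ A.card} := by
  intro a ha a' ha'
  have h1 : (prodBernoulli (wOfList l)).real (⋃ x ∈ A, openConn o x)ᶜ ≤ 0 := by
    calc (prodBernoulli (wOfList l)).real (⋃ x ∈ A, openConn o x)ᶜ
        ≤ (prodBernoulli (wOfList l)).real (openConn o a₀)ᶜ :=
          measureReal_mono (Set.compl_subset_compl.2
            (Set.subset_iUnion₂ (s := fun x (_ : x ∈ A) => openConn o x) a₀ ha₀))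
      _ = (wNotConn (wtabs n l) o a₀ : ℝ) := real_compl_openConn_eq_wNotConn hnd hq o a₀
      _ = 0 := by rw [hglue, Rat.cast_zero]
  have h2 : (prodBernoulli (wOfList l)).real (openConn a a')ᶜ ≤ η := by
    rw [real_compl_openConn_eq_wNotConn hnd hq a a']
    exact_mod_cast hpair a ha a' ha'
  have h3 := linIncCex_le_real_lowCount hnd hq o A hlow
  have hlt' : (η : ℝ) < q := by exact_mod_cast hlt
  linarith

open Classical in
/-- **Certified counterexample to the inclusive-threshold `C = 1` linear lower-tail form** (line
`bhk-superadditivity-thinning` of crux stmt-CriticalPhenomena-4575).  There is a weighted graph on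
five vertices — `K₄` on `{0, 1, 2, 3}` at weight `1/8` plus the pair `{3, 4}` at weight `1` — with
observer `o = 3 ∉ A = {0, 1, 2, 4}` such that for ALL `a, a' ∈ A`
`P(o ↮ A) + P(a ↮ a') < P(1 ≤ N ∧ 2N ≤ |A|)`, `N = #{x ∈ A : o ↔ x}`: numerically
`0 + 110789/131072 < 29155/32768` (ratio `20/19`; for `a = a'` the left side is `0`).  So the linear
lower-tail inequality with the INCLUSIVE half threshold and constant `1` fails; this refutes ONLY that
strengthening — the strict / `EN/2`-threshold forms and the crux `NoHeavyLowerTail` are untouched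
(kit job j018493; all rationals evaluated by `native_decide`). -/
theorem linearLowerTailInclusive_cex_five : ∃ (w : Sym2 (Fin 5) → unitInterval) (A : Finset (Fin 5)) (o : Fin 5), o ∉ A ∧ ∀ a ∈ A, ∀ a' ∈ A, (Literature.Probability.LatticeModels.prodBernoulli w).real (⋃ x ∈ A, Literature.Probability.Percolation.openConn o x)ᶜ + (Literature.Probability.LatticeModels.prodBernoulli w).real (Literature.Probability.Percolation.openConn a a')ᶜ < (Literature.Probability.LatticeModels.prodBernoulli w).real {ω | 1 ≤ (A.filter fun x => ω ∈ Literature.Probability.Percolation.openConn o x).card ∧ 2 * (A.filter fun x => ω ∈ Literature.Probability.Percolation.openConn o x).card ≤ A.card} := by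
  refine ⟨wOfList ([(0, 1, 1/8), (0, 2, 1/8), (0, 3, 1/8), (1, 2, 1/8), (1, 3, 1/8), (2, 3, 1/8),
    (3, 4, 1)] : List (Fin 5 × Fin 5 × ℚ)), {0, 1, 2, 4}, 3, by decide, ?_⟩
  exact linIncCex_of_checks _ (by decide) (by native_decide) {0, 1, 2, 4} 3 4 (by decide)
    (110789 / 131072) (29155 / 32768) (by native_decide) (by native_decide) (by native_decide)
    (by norm_num)

end Summit.CriticalPhenomena.PercolationContinuityZ3.Theorems
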